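/-
Copyright (c) 2026 the pub-hodgecm-mathlib formalisation cell (harness21).  Prover seat hodgecm-mathlib-A-p19 (g26): «S3-ram» seeding wave, row (e2)(b) «[T2-c]-ram», layer 3 (ii-b₁):
the anti-fixed part of the TWO-LEVEL coordinate model (unramified eigen-field over a ramified base), torus type A (road «S3-tree», crux H413).
-/
import Literature.NumberTheory.Automorphic.RamifiedCoordinateModelAntiFixed   -- ★ p846944 (this seat): `map_eq_self_iff_of_coord`, `map_add_self_eq_zero_iff_of_coord` (level `𝒪_E = 𝒪_F ⊕ 𝒪_FΠ`)
import HarnessLib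

/-!
# Type A (`θ₁⋆ = θ₁`): the anti-fixed part of `O₁ = 𝒪_E ⊕ 𝒪_E θ₁` is `Π·(fixed part)` — zero defect on the eigen-field factor

Topic `NumberTheory/Automorphic`; namespace `Literature.NumberTheory.Automorphic`.  THEOREMS ONLY (no definition, no instance, no notation, no named fact, no `sorry`).
Two-level coordinate model: the ramified base `OE = j𝒪 ⊕ j𝒪·Π` (★ p846518∕p846944 currency, involution `σ`, `σ ∘ j = j`, `σϖ_E = −ϖ_E`) and over it `O₁ = i(OE) ⊕ i(OE)·θ₁`
(`i : OE →+* O₁`, unique coordinates) with an involution `s` over `σ` (`s ∘ i = i ∘ σ`) FIXING `θ₁` — the torus type A of the CERT «[T2-c]-ram» (`⋆ = σ ⊗ 1` on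
`M = L_w(√ε)`).  Then `x = i a + i b θ₁` is `⋆`-fixed iff `σa = a ∧ σb = b`, anti-fixed iff `σa = −a ∧ σb = −b`, and since `OE⁻ = Π·OE^⋆` (★ p846944) we get
**`O₁⁻ = (iΠ)·O₁^⋆`**, i.e. the defect index `[O₁⁻ : Π O₁^⋆]` of ★ p846932 is `1` (`relIndex_map_mulLeft_eqLocus_ker_eq_one_typeA`).  (Type B, `θ₁⋆ = −θ₁`, has defect `q`; successor's.)
HONEST LABEL: HC_CM is proved only modulo the 2 remaining named inputs (hLiu418 24832, h413 24833) until rung 0 closes; unconditional algebra, count-neutral.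

## References
* [SerreLocalFields1979] J.-P. Serre, *Local Fields*, GTM 67 (1979): Ch. I §6 Prop. 15–18; Ch. V §3.
* [Hungerford1974] T. W. Hungerford, *Algebra*, GTM 73 (1974): Ch. I Thm. 4.5.
-/

set_option autoImplicit false

noncomputable section

open scoped ValuativeRel

namespace Literature.NumberTheory.Automorphic

variable {F : Type*} [Field F] [ValuativeRel F] {OE : Type*} [CommRing OE] (j : 𝒪[F] →+* OE) (ϖE : OE)
  (hcoordE : ∀ z : OE, ∃! bc : 𝒪[F] × 𝒪[F], z = j bc.1 + j bc.2 * ϖE)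
  (σ : OE →+* OE) (hσj : ∀ b, σ (j b) = j b) (hσϖ : σ ϖE = -ϖE) (h2 : ∀ b : 𝒪[F], b * 2 = 0 → b = 0)
  {O₁ : Type*} [CommRing O₁] (i : OE →+* O₁) (θ₁ : O₁)
  (hcoord₁ : ∀ z : O₁, ∃! ab : OE × OE, z = i ab.1 + i ab.2 * θ₁)
  (s : O₁ →+* O₁) (hsi : ∀ a, s (i a) = i (σ a)) (hsθ : s θ₁ = θ₁)

include hcoord₁ in
/-- Uniqueness of the `O₁`-coordinates, two-sided form. [cite: SerreLocalFields1979, Ch. I §6 Prop. 18] -/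
theorem coord_unique_level₁ {a b a' b' : OE} (h : i a + i b * θ₁ = i a' + i b' * θ₁) : a = a' ∧ b = b' := by
  obtain ⟨ab, -, huniq⟩ := hcoord₁ (i a + i b * θ₁)
  have h1 : (a, b) = ab := huniq (a, b) rfl
  have h2 : (a', b') = ab := huniq (a', b') h
  have := h1.trans h2.symm
  exact ⟨congrArg Prod.fst this, congrArg Prod.snd this⟩

include hcoordE h2 in
/-- `2` is a non-zero-divisor of `OE` (coordinatewise). [cite: SerreLocalFields1979, Ch. I §6 Prop. 18] -/
theorem eq_zero_of_mul_two_level (a : OE) (ha : a * 2 = 0) : a = 0 := by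
  obtain ⟨⟨b, c⟩, rfl, -⟩ := hcoordE a
  have h' : j (b * 2) + j (c * 2) * ϖE = j 0 + j 0 * ϖE := by
    rw [map_zero, zero_mul, add_zero, map_mul, map_mul, map_ofNat]
    have : (j b + j c * ϖE) * 2 = j b * 2 + j c * 2 * ϖE := by ring
    rw [← this, ha]
  obtain ⟨hb, hc⟩ := coord_unique j ϖE hcoordE h'
  rw [h2 b hb, h2 c hc, map_zero, zero_mul, add_zero]

include hcoord₁ hsi hsθ in
/-- **TYPE A: `s x = x ↔ (σa = a ∧ σb = b)` and `s x + x = 0 ↔ (σa + a = 0 ∧ σb + b = 0)`** for `x = i a + i b θ₁`. [cite: SerreLocalFields1979, Ch. I §6 Prop. 15] -/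
theorem fixed_anti_iff_typeA (a b : OE) :
    (s (i a + i b * θ₁) = i a + i b * θ₁ ↔ σ a = a ∧ σ b = b) ∧ (s (i a + i b * θ₁) + (i a + i b * θ₁) = 0 ↔ σ a + a = 0 ∧ σ b + b = 0) := by
  have hs : s (i a + i b * θ₁) = i (σ a) + i (σ b) * θ₁ := by rw [map_add, map_mul, hsi, hsi, hsθ]
  refine ⟨?_, ?_⟩
  · rw [hs]
    constructor
    · intro h; exact coord_unique_level₁ i θ₁ hcoord₁ h
    · rintro ⟨ha, hb⟩; rw [ha, hb]
  · rw [hs]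
    constructor
    · intro h
      have h' : i (σ a + a) + i (σ b + b) * θ₁ = i 0 + i 0 * θ₁ := by
        rw [map_zero, zero_mul, add_zero, map_add, map_add]
        have : i (σ a) + i (σ b) * θ₁ + (i a + i b * θ₁) = i (σ a) + i a + (i (σ b) + i b) * θ₁ := by ring
        rw [← this, h]
      exact coord_unique_level₁ i θ₁ hcoord₁ h'
    · rintro ⟨ha, hb⟩
      have : i (σ a) + i (σ b) * θ₁ + (i a + i b * θ₁) = i (σ a + a) + i (σ b + b) * θ₁ := by rw [map_add, map_add]; ring
      rw [this, ha, hb, map_zero, zero_mul, add_zero]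

include hcoordE hσj hσϖ h2 hcoord₁ hsi hsθ in
/-- **TYPE A: `(iΠ)·O₁^⋆ = O₁⁻`** — the image of the `⋆`-fixed subgroup under `x ↦ (iΠ)x` is the anti-fixed subgroup (each `OE`-coordinate: ★ `map_add_self_eq_zero_iff_of_coord`,
`map_eq_self_iff_of_coord`). [cite: SerreLocalFields1979, Ch. I §6 Prop. 15, Ch. V §3] [cite: Hungerford1974, Ch. I Thm. 4.5] -/
theorem map_mulLeft_eqLocus_eq_ker_typeA :
    ((RingHom.eqLocus s (RingHom.id O₁)).toAddSubgroup).map (AddMonoidHom.mulLeft (i ϖE)) = (s.toAddMonoidHom + AddMonoidHom.id O₁).ker := by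
  have hfixE := map_eq_self_iff_of_coord j ϖE hcoordE σ hσj hσϖ h2
  have hantiE := map_add_self_eq_zero_iff_of_coord j ϖE hcoordE σ hσj hσϖ h2
  ext x
  rw [AddMonoidHom.mem_ker]
  change x ∈ ((RingHom.eqLocus s (RingHom.id O₁)).toAddSubgroup).map (AddMonoidHom.mulLeft (i ϖE)) ↔ s x + x = 0
  obtain ⟨⟨a, b⟩, rfl, -⟩ := hcoord₁ x
  rw [(fixed_anti_iff_typeA σ i θ₁ hcoord₁ s hsi hsθ a b).2, hantiE, hantiE]
  constructor
  · rintro ⟨y, hy, hyx⟩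
    have hy' : s y = y := hy
    obtain ⟨⟨a', b'⟩, rfl, -⟩ := hcoord₁ y
    obtain ⟨ha', hb'⟩ := (fixed_anti_iff_typeA σ i θ₁ hcoord₁ s hsi hsθ a' b').1.1 hy'
    obtain ⟨c, rfl⟩ := (hfixE _).1 ha'
    obtain ⟨d, rfl⟩ := (hfixE _).1 hb'
    have hyx' : i a + i b * θ₁ = i (j c * ϖE) + i (j d * ϖE) * θ₁ := by
      rw [← hyx]
      change i ϖE * (i (j c) + i (j d) * θ₁) = _
      simp only [map_mul]; ring
    obtain ⟨ha, hb⟩ := coord_unique_level₁ i θ₁ hcoord₁ hyx'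
    exact ⟨⟨c, ha⟩, ⟨d, hb⟩⟩
  · rintro ⟨⟨c, hc⟩, ⟨d, hd⟩⟩
    refine ⟨i (j c) + i (j d) * θ₁, ?_, ?_⟩
    · change s (i (j c) + i (j d) * θ₁) = i (j c) + i (j d) * θ₁
      exact (fixed_anti_iff_typeA σ i θ₁ hcoord₁ s hsi hsθ (j c) (j d)).1.2 ⟨hσj c, hσj d⟩
    · change i ϖE * (i (j c) + i (j d) * θ₁) = i a + i b * θ₁
      rw [hc, hd]; simp only [map_mul]; ring

include hcoordE hσj hσϖ h2 hcoord₁ hsi hsθ in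
/-- … hence the defect index `[O₁⁻ : (iΠ)·O₁^⋆] = 1` in type A. [cite: Hungerford1974, Ch. I Thm. 4.5] -/
theorem relIndex_map_mulLeft_eqLocus_ker_eq_one_typeA :
    (((RingHom.eqLocus s (RingHom.id O₁)).toAddSubgroup).map (AddMonoidHom.mulLeft (i ϖE))).relIndex (s.toAddMonoidHom + AddMonoidHom.id O₁).ker = 1 := by
  rw [map_mulLeft_eqLocus_eq_ker_typeA j ϖE hcoordE σ hσj hσϖ h2 i θ₁ hcoord₁ s hsi hsθ, AddSubgroup.relIndex_self]

end Literature.NumberTheory.Automorphic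

end
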